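import Mathlib
import Summits.Ventures.FusionMHD.Bench.SAlphaU067Checks4
import Literature.MathematicalPhysics.MHD.BallooningSAlphaConjugatePoint
import HarnessLib

/-!
# F3 — THE `s–α` BALLOONING MODEL AT `(s, α) = (1, 67/100)` IS UNSTABLE, BY A KERNEL-CHECKED ENCLOSURE: the even solution `X₀` of (12.97)
# CHANGES SIGN between `θ = 5` and `θ = 7` (60 validated Taylor steps, Moore's HOE test in exact rational interval arithmetic, `decide`d
# by the Lean kernel in `SAlphaU067Checks{1,2,3,4}.lean`), hence — by Jacobi's necessary condition
# (`Literature/…/BallooningSAlphaConjugatePoint.lean`) — a window `[−z, z + 1/4]`, `z ∈ (5, 7)`, carries a piecewise-`C¹` trial function of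
# NEGATIVE `s–α` energy: the validated-ODE TWIN of ★ #192's explicit (`TT`) witness at the same point
(venture LADDER-GRIDFUSION, rung F3; cell `gridfusion`, typed by gridfusion-lit-3 (g13), 2026-08-28.  ONE composition file: 0 `def … : Prop`
facts, 0 kit jobs, no `native_decide`, no floating point; the stage list was FOUND by lit-3's untrusted Lean-interpreter search and is
CERTIFIED only by the kernel facts `uokJJ` of the check files, assembled here into `chain_check`.)

## The statement (three columns, never merged)
CERTIFIED (kernel, this file): for the `s–α` model EXACTLY as typed in `Literature/MathematicalPhysics/MHD/BallooningSAlpha.lean`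
(Freidberg 2014 §12.6.2 eq. (12.97), `Λ = sθ − α sin θ`) at `s = 1`, `α = 67/100`:
* `chain_check` / `exists_solution`: the clock system `y′ = clockField 1 (67/100) (y)` has a solution on `[0, 15/2]` from `y(0) = (0, 1, 0)`
  (the EVEN solution `X₀(0) = 1`, `X₀′(0) = 0`), and EVERY such solution has `X₀(5) ≥ 0.0125325 > 0`, `X₀(7) ≤ −0.0250691 < 0`
  (hand-over boxes `W₄₀`, `W₅₆`) and `P = (1 + Λ²)X₀′ ≤ −0.67 < 0` on `[5, 7]` (a-priori boxes `S₄₀ … S₅₆`) — `X_five_pos`, `X_seven_neg`,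
  `P_neg`;
* ★★ `unstable_067`: THERE IS `z ∈ (5, 7)` AND A TRIAL FUNCTION ON `[−z, z + 1/4]`, continuous, piecewise `C¹` with corners `z − 1/4`, `z`,
  vanishing at both ends, with NEGATIVE one-surface energy — `∃ z ε, Ballooning.SAlpha.UnstableWitnessPW3 1 (67/100) (−z) (z + 1/4) (z − 1/4) z …`
  (the three pieces are the reflected even solution, it plus `ε`·hat, and `ε`·hat) — by lit-3's socket
  `exists_unstableWitnessPW3_of_signChange` (Hartman XI §6 Thm 6.2 «if» half made constructive).
VALIDATED (juxtaposed): ★ #192 certifies the same point by an explicit `C¹` trial function in `[−2π, 2π]` (Taylor-model quadrature);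
lit-3's float shadow: first zero of `X₀` at `θ ≈ 5.60`; Freidberg Fig. 12.5 (`α_crit ≈ 0.6` at `s = 1`).  The two witness classes
bracket the SAME boundary (every Picone phase excludes both: `EnergyDominatesOn.not_unstableWitnessPW3`).
MODELLED: the `s–α` model (large-aspect-ratio circular tokamak, high-`n` ordering, `θ₀ = 0`, ideal MHD); «unstable» = the model's
one-surface quadratic form is negative on an admissible (Hartman `A₁`) trial function supported in a window; the representation step
(Connor–Hastie–Taylor) is quoted (`BallooningSAlpha.lean`) / skeleton typed (`BallooningTransform.lean`); no device.

## Sources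
* J. P. Freidberg, *Ideal MHD*, CUP 2014 [Freidberg2014] §12.3 (Newcomb procedure), §12.6.2 eq. (12.97) (via the imports).
* P. Hartman, *ODE*, SIAM 2002 [Hartman2002] Ch. XI §6 Thm. 6.2 (via `BallooningSAlphaConjugatePoint.lean`).
* R. E. Moore, *Methods and Applications of Interval Analysis*, SIAM 1979 [Moore1979] §8.1 (8.13) (via `ElementaryFieldChainCertificate.lean`).
-/

noncomputable section

open Real Set NonemptyInterval
open Literature.Analysis.ODE Literature.Analysis.ValidatedNumerics Literature.Analysis.ValidatedNumerics.ITaylor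
open Literature.MathematicalPhysics.MHD.Ballooning.SAlpha

namespace Summit.Ventures.FusionMHD.Bench.SAlphaU067

/-! ## §1 The code list denotes the clock field at `(1, 67/100)` -/

/-- THE CODE LIST DENOTES lit-3's `clockField 1 (67/100)`. [cite: Freidberg2014, §12.6.2 eq. (12.97)] -/
theorem fieldFun_sAlphaCode : FExpr.fieldFun sAlphaCode = clockField 1 (67/100) := by
  funext y i
  fin_cases i
  · simp [FExpr.fieldFun, sAlphaCode, FExpr.eval, clockField]
  · simp [FExpr.fieldFun, sAlphaCode, FExpr.eval, clockField, bending, shearParam]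
  · simp [FExpr.fieldFun, sAlphaCode, FExpr.eval, clockField, drive, shearParam]

/-! ## §2 Kernel acceptance, mesh, existence, the certified boxes -/

/-- ★ **THE KERNEL ACCEPTS THE 60-STEP TRANSCRIPT** (assembled from `uok00 … uok59` of the check files: each `certAt` fact is restated locally in the stage-literal form — a
definitional unfolding — and the checker is unfolded along the stage list). [cite: Moore1979, §8.1 eq. (8.13)]
[cite: NedialkovJacksonCorliss1999, §5 Algorithm I] -/
theorem chain_check : EChainCert.check chain = true := by
  have c00 : (st00.toECert sAlphaCode cfg).check = true := uok00c
  have b00 : boxLE (st00.toECert sAlphaCode cfg).endBox st01.init = true := uok00b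
  have c01 : (st01.toECert sAlphaCode cfg).check = true := uok01c
  have b01 : boxLE (st01.toECert sAlphaCode cfg).endBox st02.init = true := uok01b
  have c02 : (st02.toECert sAlphaCode cfg).check = true := uok02c
  have b02 : boxLE (st02.toECert sAlphaCode cfg).endBox st03.init = true := uok02b
  have c03 : (st03.toECert sAlphaCode cfg).check = true := uok03c
  have b03 : boxLE (st03.toECert sAlphaCode cfg).endBox st04.init = true := uok03b
  have c04 : (st04.toECert sAlphaCode cfg).check = true := uok04c
  have b04 : boxLE (st04.toECert sAlphaCode cfg).endBox st05.init = true := uok04b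
  have c05 : (st05.toECert sAlphaCode cfg).check = true := uok05c
  have b05 : boxLE (st05.toECert sAlphaCode cfg).endBox st06.init = true := uok05b
  have c06 : (st06.toECert sAlphaCode cfg).check = true := uok06c
  have b06 : boxLE (st06.toECert sAlphaCode cfg).endBox st07.init = true := uok06b
  have c07 : (st07.toECert sAlphaCode cfg).check = true := uok07c
  have b07 : boxLE (st07.toECert sAlphaCode cfg).endBox st08.init = true := uok07b
  have c08 : (st08.toECert sAlphaCode cfg).check = true := uok08c
  have b08 : boxLE (st08.toECert sAlphaCode cfg).endBox st09.init = true := uok08b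
  have c09 : (st09.toECert sAlphaCode cfg).check = true := uok09c
  have b09 : boxLE (st09.toECert sAlphaCode cfg).endBox st10.init = true := uok09b
  have c10 : (st10.toECert sAlphaCode cfg).check = true := uok10c
  have b10 : boxLE (st10.toECert sAlphaCode cfg).endBox st11.init = true := uok10b
  have c11 : (st11.toECert sAlphaCode cfg).check = true := uok11c
  have b11 : boxLE (st11.toECert sAlphaCode cfg).endBox st12.init = true := uok11b
  have c12 : (st12.toECert sAlphaCode cfg).check = true := uok12c
  have b12 : boxLE (st12.toECert sAlphaCode cfg).endBox st13.init = true := uok12b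
  have c13 : (st13.toECert sAlphaCode cfg).check = true := uok13c
  have b13 : boxLE (st13.toECert sAlphaCode cfg).endBox st14.init = true := uok13b
  have c14 : (st14.toECert sAlphaCode cfg).check = true := uok14c
  have b14 : boxLE (st14.toECert sAlphaCode cfg).endBox st15.init = true := uok14b
  have c15 : (st15.toECert sAlphaCode cfg).check = true := uok15c
  have b15 : boxLE (st15.toECert sAlphaCode cfg).endBox st16.init = true := uok15b
  have c16 : (st16.toECert sAlphaCode cfg).check = true := uok16c
  have b16 : boxLE (st16.toECert sAlphaCode cfg).endBox st17.init = true := uok16b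
  have c17 : (st17.toECert sAlphaCode cfg).check = true := uok17c
  have b17 : boxLE (st17.toECert sAlphaCode cfg).endBox st18.init = true := uok17b
  have c18 : (st18.toECert sAlphaCode cfg).check = true := uok18c
  have b18 : boxLE (st18.toECert sAlphaCode cfg).endBox st19.init = true := uok18b
  have c19 : (st19.toECert sAlphaCode cfg).check = true := uok19c
  have b19 : boxLE (st19.toECert sAlphaCode cfg).endBox st20.init = true := uok19b
  have c20 : (st20.toECert sAlphaCode cfg).check = true := uok20c
  have b20 : boxLE (st20.toECert sAlphaCode cfg).endBox st21.init = true := uok20b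
  have c21 : (st21.toECert sAlphaCode cfg).check = true := uok21c
  have b21 : boxLE (st21.toECert sAlphaCode cfg).endBox st22.init = true := uok21b
  have c22 : (st22.toECert sAlphaCode cfg).check = true := uok22c
  have b22 : boxLE (st22.toECert sAlphaCode cfg).endBox st23.init = true := uok22b
  have c23 : (st23.toECert sAlphaCode cfg).check = true := uok23c
  have b23 : boxLE (st23.toECert sAlphaCode cfg).endBox st24.init = true := uok23b
  have c24 : (st24.toECert sAlphaCode cfg).check = true := uok24c
  have b24 : boxLE (st24.toECert sAlphaCode cfg).endBox st25.init = true := uok24b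
  have c25 : (st25.toECert sAlphaCode cfg).check = true := uok25c
  have b25 : boxLE (st25.toECert sAlphaCode cfg).endBox st26.init = true := uok25b
  have c26 : (st26.toECert sAlphaCode cfg).check = true := uok26c
  have b26 : boxLE (st26.toECert sAlphaCode cfg).endBox st27.init = true := uok26b
  have c27 : (st27.toECert sAlphaCode cfg).check = true := uok27c
  have b27 : boxLE (st27.toECert sAlphaCode cfg).endBox st28.init = true := uok27b
  have c28 : (st28.toECert sAlphaCode cfg).check = true := uok28c
  have b28 : boxLE (st28.toECert sAlphaCode cfg).endBox st29.init = true := uok28b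
  have c29 : (st29.toECert sAlphaCode cfg).check = true := uok29c
  have b29 : boxLE (st29.toECert sAlphaCode cfg).endBox st30.init = true := uok29b
  have c30 : (st30.toECert sAlphaCode cfg).check = true := uok30c
  have b30 : boxLE (st30.toECert sAlphaCode cfg).endBox st31.init = true := uok30b
  have c31 : (st31.toECert sAlphaCode cfg).check = true := uok31c
  have b31 : boxLE (st31.toECert sAlphaCode cfg).endBox st32.init = true := uok31b
  have c32 : (st32.toECert sAlphaCode cfg).check = true := uok32c
  have b32 : boxLE (st32.toECert sAlphaCode cfg).endBox st33.init = true := uok32b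
  have c33 : (st33.toECert sAlphaCode cfg).check = true := uok33c
  have b33 : boxLE (st33.toECert sAlphaCode cfg).endBox st34.init = true := uok33b
  have c34 : (st34.toECert sAlphaCode cfg).check = true := uok34c
  have b34 : boxLE (st34.toECert sAlphaCode cfg).endBox st35.init = true := uok34b
  have c35 : (st35.toECert sAlphaCode cfg).check = true := uok35c
  have b35 : boxLE (st35.toECert sAlphaCode cfg).endBox st36.init = true := uok35b
  have c36 : (st36.toECert sAlphaCode cfg).check = true := uok36c
  have b36 : boxLE (st36.toECert sAlphaCode cfg).endBox st37.init = true := uok36b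
  have c37 : (st37.toECert sAlphaCode cfg).check = true := uok37c
  have b37 : boxLE (st37.toECert sAlphaCode cfg).endBox st38.init = true := uok37b
  have c38 : (st38.toECert sAlphaCode cfg).check = true := uok38c
  have b38 : boxLE (st38.toECert sAlphaCode cfg).endBox st39.init = true := uok38b
  have c39 : (st39.toECert sAlphaCode cfg).check = true := uok39c
  have b39 : boxLE (st39.toECert sAlphaCode cfg).endBox st40.init = true := uok39b
  have c40 : (st40.toECert sAlphaCode cfg).check = true := uok40c
  have b40 : boxLE (st40.toECert sAlphaCode cfg).endBox st41.init = true := uok40b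
  have c41 : (st41.toECert sAlphaCode cfg).check = true := uok41c
  have b41 : boxLE (st41.toECert sAlphaCode cfg).endBox st42.init = true := uok41b
  have c42 : (st42.toECert sAlphaCode cfg).check = true := uok42c
  have b42 : boxLE (st42.toECert sAlphaCode cfg).endBox st43.init = true := uok42b
  have c43 : (st43.toECert sAlphaCode cfg).check = true := uok43c
  have b43 : boxLE (st43.toECert sAlphaCode cfg).endBox st44.init = true := uok43b
  have c44 : (st44.toECert sAlphaCode cfg).check = true := uok44c
  have b44 : boxLE (st44.toECert sAlphaCode cfg).endBox st45.init = true := uok44b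
  have c45 : (st45.toECert sAlphaCode cfg).check = true := uok45c
  have b45 : boxLE (st45.toECert sAlphaCode cfg).endBox st46.init = true := uok45b
  have c46 : (st46.toECert sAlphaCode cfg).check = true := uok46c
  have b46 : boxLE (st46.toECert sAlphaCode cfg).endBox st47.init = true := uok46b
  have c47 : (st47.toECert sAlphaCode cfg).check = true := uok47c
  have b47 : boxLE (st47.toECert sAlphaCode cfg).endBox st48.init = true := uok47b
  have c48 : (st48.toECert sAlphaCode cfg).check = true := uok48c
  have b48 : boxLE (st48.toECert sAlphaCode cfg).endBox st49.init = true := uok48b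
  have c49 : (st49.toECert sAlphaCode cfg).check = true := uok49c
  have b49 : boxLE (st49.toECert sAlphaCode cfg).endBox st50.init = true := uok49b
  have c50 : (st50.toECert sAlphaCode cfg).check = true := uok50c
  have b50 : boxLE (st50.toECert sAlphaCode cfg).endBox st51.init = true := uok50b
  have c51 : (st51.toECert sAlphaCode cfg).check = true := uok51c
  have b51 : boxLE (st51.toECert sAlphaCode cfg).endBox st52.init = true := uok51b
  have c52 : (st52.toECert sAlphaCode cfg).check = true := uok52c
  have b52 : boxLE (st52.toECert sAlphaCode cfg).endBox st53.init = true := uok52b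
  have c53 : (st53.toECert sAlphaCode cfg).check = true := uok53c
  have b53 : boxLE (st53.toECert sAlphaCode cfg).endBox st54.init = true := uok53b
  have c54 : (st54.toECert sAlphaCode cfg).check = true := uok54c
  have b54 : boxLE (st54.toECert sAlphaCode cfg).endBox st55.init = true := uok54b
  have c55 : (st55.toECert sAlphaCode cfg).check = true := uok55c
  have b55 : boxLE (st55.toECert sAlphaCode cfg).endBox st56.init = true := uok55b
  have c56 : (st56.toECert sAlphaCode cfg).check = true := uok56c
  have b56 : boxLE (st56.toECert sAlphaCode cfg).endBox st57.init = true := uok56b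
  have c57 : (st57.toECert sAlphaCode cfg).check = true := uok57c
  have b57 : boxLE (st57.toECert sAlphaCode cfg).endBox st58.init = true := uok57b
  have c58 : (st58.toECert sAlphaCode cfg).check = true := uok58c
  have b58 : boxLE (st58.toECert sAlphaCode cfg).endBox st59.init = true := uok58b
  have c59 : (st59.toECert sAlphaCode cfg).check = true := uok59c
  have b59 : boxLE (st59.toECert sAlphaCode cfg).endBox finalBox = true := uok59b
  show eChainCheck sAlphaCode cfg finalBox stages = true
  simp only [stages, eChainCheck, nextInit, c00, b00, c01, b01, c02, b02, c03, b03, c04, b04, c05, b05, c06, b06, c07,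
    b07, c08, b08, c09, b09, c10, b10, c11, b11, c12, b12, c13, b13, c14, b14, c15, b15, c16, b16, c17, b17, c18, b18,
    c19, b19, c20, b20, c21, b21, c22, b22, c23, b23, c24, b24, c25, b25, c26, b26, c27, b27, c28, b28, c29, b29, c30,
    b30, c31, b31, c32, b32, c33, b33, c34, b34, c35, b35, c36, b36, c37, b37, c38, b38, c39, b39, c40, b40, c41, b41,
    c42, b42, c43, b43, c44, b44, c45, b45, c46, b46, c47, b47, c48, b48, c49, b49, c50, b50, c51, b51, c52, b52, c53,
    b53, c54, b54, c55, b55, c56, b56, c57, b57, c58, b58, c59, b59, Bool.and_self]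

/-- 60 steps. [cite: Moore1979, §8.1 eq. (8.13)] -/
theorem chain_size : chain.size = 60 := rfl

/-- Every step has length `1/8`. [cite: Moore1979, §8.1 eq. (8.13)] -/
theorem step_eq : ∀ j < 60, (chain.toHOEChain.stageAt j).step = 1 / 8 := by
  decide +kernel

/-- The mesh is uniform: `τⱼ = j/8` for `j ≤ 60`. [cite: Moore1979, §8.1 eq. (8.13)] -/
theorem mesh_eq : ∀ j ≤ 60, chain.toHOEChain.mesh j = (j : ℝ) / 8 := by
  intro j hj
  induction j with
  | zero => simp
  | succ k ih =>
    rw [HOEChainCert.mesh_succ, ih (by omega), step_eq k (by omega)]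
    push_cast
    ring

/-- The horizon is `τ₆₀ = 15/2`. [cite: Moore1979, §8.1 eq. (8.13)] -/
theorem mesh_size : chain.toHOEChain.mesh chain.size = 15 / 2 := by
  rw [chain_size, mesh_eq 60 le_rfl]; norm_num

/-- The initial value `(0, 1, 0)` is `W₀`. [cite: Moore1979, §8.1 eq. (8.13)] -/
theorem init_mem : (![0, 1, 0] : Fin 3 → ℝ) ∈ boxSet (castBox st00.init) := by
  rw [mem_boxSet_iff]
  intro i
  fin_cases i
  · show (0 : ℝ) ∈ (NonemptyInterval.pure (0 : ℚ)).ratCast ℝ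
    rw [ratCast_pure, Rat.cast_zero]; exact mem_pure_self _
  · show (1 : ℝ) ∈ (NonemptyInterval.pure (1 : ℚ)).ratCast ℝ
    rw [ratCast_pure, Rat.cast_one]; exact mem_pure_self _
  · show (0 : ℝ) ∈ (NonemptyInterval.pure (0 : ℚ)).ratCast ℝ
    rw [ratCast_pure, Rat.cast_zero]; exact mem_pure_self _

/-- ★ EXISTENCE ON `[0, 15/2]` of the even solution in clock form, in lit-3's socket format. [cite: Moore1979, §8.1 eq. (8.13)]
[cite: Freidberg2014, §12.6.2 eq. (12.97)] -/
theorem exists_solution :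
    ∃ y : ℝ → Fin 3 → ℝ, y 0 = ![0, 1, 0] ∧
      ∀ t ∈ Icc (0 : ℝ) (15 / 2), HasDerivWithinAt y (clockField 1 (67/100) (y t)) (Icc (0 : ℝ) (15 / 2)) t := by
  have h := (EChainCert.sound chain_check init_mem).1
  rwa [mesh_size, show chain.field = sAlphaCode from rfl, fieldFun_sAlphaCode] at h

/-- The certified boxes used below: `X`-lower end of `W₄₀` (`t = 5`), `X`-upper end of `W₅₆` (`t = 7`), and the `P`-upper ends of the
a-priori boxes `S₄₀ … S₅₆`. [cite: Moore1979, §8.1 eq. (8.13)] -/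
theorem boxes_facts :
    (1 / 100 : ℚ) ≤ ((chain.stageAt 40).init 1).fst ∧ ((chain.stageAt 56).init 1).snd ≤ -(1 / 50 : ℚ) ∧
      ∀ j, 40 ≤ j → j < 57 → ((chain.stageAt j).apriori 2).snd ≤ -(1 / 2 : ℚ) := by
  refine ⟨by decide +kernel, by decide +kernel, ?_⟩
  decide +kernel

/-- Rewriting the solution hypothesis into the certificate's format. [cite: Moore1979, §8.1 eq. (8.13)] -/
private theorem sol_format {y : ℝ → Fin 3 → ℝ}
    (hy : ∀ t ∈ Icc (0 : ℝ) (15 / 2), HasDerivWithinAt y (clockField 1 (67/100) (y t)) (Icc (0 : ℝ) (15 / 2)) t) :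
    ∀ t ∈ Icc 0 (chain.toHOEChain.mesh chain.size),
      HasDerivWithinAt y (FExpr.fieldFun chain.field (y t)) (Icc 0 (chain.toHOEChain.mesh chain.size)) t := by
  rw [mesh_size]
  show ∀ t ∈ Icc (0 : ℝ) (15 / 2), HasDerivWithinAt y (FExpr.fieldFun sAlphaCode (y t)) (Icc (0 : ℝ) (15 / 2)) t
  rw [fieldFun_sAlphaCode]; exact hy

/-- ★ `X₀(5) > 0`: every solution from `(0, 1, 0)` has `X`-component `≥ 1/100 > 0` at `θ = 5` (hand-over box `W₄₀`).
[cite: Moore1979, §8.1 eq. (8.13)] -/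
theorem X_five_pos {y : ℝ → Fin 3 → ℝ} (hy0 : y 0 = ![0, 1, 0])
    (hy : ∀ t ∈ Icc (0 : ℝ) (15 / 2), HasDerivWithinAt y (clockField 1 (67/100) (y t)) (Icc (0 : ℝ) (15 / 2)) t) :
    0 < y 5 1 := by
  have hW := ((EChainCert.sound chain_check init_mem).2 y hy0 (sol_format hy)).1 40 (by rw [chain_size]; norm_num)
  rw [mesh_eq 40 (by norm_num)] at hW
  norm_num at hW
  rw [mem_boxSet_iff] at hW
  have h1 := hW 1
  rw [castBox_apply, mem_ratCast_iff] at h1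
  have hq : ((1 / 100 : ℚ) : ℝ) ≤ (((chain.stageAt 40).init 1).fst : ℝ) := by exact_mod_cast boxes_facts.1
  have : (0 : ℝ) < ((1 / 100 : ℚ) : ℝ) := by norm_num
  exact lt_of_lt_of_le (lt_of_lt_of_le this hq) h1.1

/-- ★ `X₀(7) < 0`: every solution from `(0, 1, 0)` has `X`-component `≤ −1/50 < 0` at `θ = 7` (hand-over box `W₅₆`) — THE SIGN CHANGE.
[cite: Moore1979, §8.1 eq. (8.13)] -/
theorem X_seven_neg {y : ℝ → Fin 3 → ℝ} (hy0 : y 0 = ![0, 1, 0])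
    (hy : ∀ t ∈ Icc (0 : ℝ) (15 / 2), HasDerivWithinAt y (clockField 1 (67/100) (y t)) (Icc (0 : ℝ) (15 / 2)) t) :
    y 7 1 < 0 := by
  have hW := ((EChainCert.sound chain_check init_mem).2 y hy0 (sol_format hy)).1 56 (by rw [chain_size]; norm_num)
  rw [mesh_eq 56 (by norm_num)] at hW
  norm_num at hW
  rw [mem_boxSet_iff] at hW
  have h1 := hW 1
  rw [castBox_apply, mem_ratCast_iff] at h1
  have hq : (((chain.stageAt 56).init 1).snd : ℝ) ≤ ((-(1 / 50) : ℚ) : ℝ) := by exact_mod_cast boxes_facts.2.1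
  have : ((-(1 / 50) : ℚ) : ℝ) < 0 := by norm_num
  exact lt_of_le_of_lt (h1.2.trans hq) this

/-- Every `t ∈ [5, 7]` lies in a step interval `[j/8, (j+1)/8]` with `40 ≤ j ≤ 56`. [folklore] -/
private theorem exists_step_mid {t : ℝ} (ht : t ∈ Icc (5 : ℝ) 7) :
    ∃ j, 40 ≤ j ∧ j < 57 ∧ t ∈ Icc (chain.toHOEChain.mesh j) (chain.toHOEChain.mesh (j + 1)) := by
  set j := min ⌊8 * t⌋₊ 56 with hj
  have h8t : (40 : ℝ) ≤ 8 * t := by linarith [ht.1]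
  have hfl : (⌊8 * t⌋₊ : ℝ) ≤ 8 * t := Nat.floor_le (by linarith)
  have h40 : 40 ≤ ⌊8 * t⌋₊ := Nat.le_floor (by exact_mod_cast h8t)
  have hj40 : 40 ≤ j := le_min h40 (by norm_num)
  have hj57 : j < 57 := by omega
  refine ⟨j, hj40, hj57, ?_⟩
  rw [mesh_eq j (by omega), mesh_eq (j + 1) (by omega)]
  have hjle : (j : ℝ) ≤ ⌊8 * t⌋₊ := by exact_mod_cast min_le_left _ _
  constructor
  · rw [div_le_iff₀ (by norm_num : (0 : ℝ) < 8)]; linarith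
  · rw [le_div_iff₀ (by norm_num : (0 : ℝ) < 8)]
    rcases le_or_gt ⌊8 * t⌋₊ 56 with h | h
    · have hj' : j = ⌊8 * t⌋₊ := by rw [hj]; exact min_eq_left h
      have hlt : 8 * t < (⌊8 * t⌋₊ : ℝ) + 1 := Nat.lt_floor_add_one _
      rw [hj']; push_cast; linarith
    · have hj' : j = 56 := by rw [hj]; exact min_eq_right h.le
      rw [hj']; push_cast; linarith [ht.2]

/-- ★ `P < 0` ON `[5, 7]`: the flux `P = (1 + Λ²)X₀′` of every solution from `(0, 1, 0)` is `≤ −1/2 < 0` throughout `[5, 7]` (a-priori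
boxes `S₄₀ … S₅₆`) — the zero of `X₀` is transversal. [cite: Moore1979, §8.1 eq. (8.13)] -/
theorem P_neg {y : ℝ → Fin 3 → ℝ} (hy0 : y 0 = ![0, 1, 0])
    (hy : ∀ t ∈ Icc (0 : ℝ) (15 / 2), HasDerivWithinAt y (clockField 1 (67/100) (y t)) (Icc (0 : ℝ) (15 / 2)) t)
    {t : ℝ} (ht : t ∈ Icc (5 : ℝ) 7) : y t 2 < 0 := by
  have hsound := ((EChainCert.sound chain_check init_mem).2 y hy0 (sol_format hy)).2
  obtain ⟨j, hj40, hj57, hjt⟩ := exists_step_mid ht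
  have hmem := (hsound j (by rw [chain_size]; omega) t hjt).1
  rw [mem_boxSet_iff] at hmem
  have h2 := hmem 2
  rw [castBox_apply, mem_ratCast_iff] at h2
  have hq : (((chain.stageAt j).apriori 2).snd : ℝ) ≤ ((-(1 / 2) : ℚ) : ℝ) := by
    exact_mod_cast boxes_facts.2.2 j hj40 hj57
  have : ((-(1 / 2) : ℚ) : ℝ) < 0 := by norm_num
  exact lt_of_le_of_lt (h2.2.trans hq) this

/-! ## §3 The instability certificate -/

/-- ★★ **THE `s–α` MODEL IS UNSTABLE AT `(s, α) = (1, 67/100)` — BY ENCLOSURE.**  There are `z ∈ (5, 7)` and `ε` such that the window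
`[−z, z + 1/4]` carries a piecewise-`C¹` instability witness (Hartman class `A₁`): the reflected even solution on `[−z, z − 1/4]`, the
solution plus `ε`·(rising hat) on `[z − 1/4, z]`, and `ε`·(falling hat) on `[z, z + 1/4]`, with NEGATIVE total `s–α` energy — from the
kernel-certified sign change `X₀(5) > 0 > X₀(7)` with `P < 0` on `[5, 7]` (§2) through the conjugate-point socket.
[cite: Hartman2002, Ch. XI §6 Thm. 6.2 (proof «if»)] with [Freidberg2014] §12.3 after (12.40) («zero crossing ⇒ unstable»); enclosure
[cite: Moore1979, §8.1 eq. (8.13)] -/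
theorem unstable_067 : ∃ X P : ℝ → ℝ, ∃ z ∈ Ioo (5 : ℝ) 7, ∃ ε : ℝ,
    UnstableWitnessPW3 1 (67/100) (-z) (z + 1/4) (z - 1/4) z (evenExt X) (fun θ => oddExt P θ / bending 1 (67/100) θ)
      (fun θ => evenExt X θ + ε * hatUp z (1/4) θ) (fun θ => oddExt P θ / bending 1 (67/100) θ + ε * (1 / (1/4)))
      (fun θ => ε * hatDown z (1/4) θ) (fun _ => ε * (-1 / (1/4))) := by
  obtain ⟨y, hy0, hy⟩ := exists_solution
  have hcomp : ∀ t ∈ Icc (0 : ℝ) (15 / 2), ∀ i,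
      HasDerivWithinAt (fun t => y t i) (clockField 1 (67/100) (y t) i) (Icc (0 : ℝ) (15 / 2)) t :=
    fun t ht i => (hasDerivWithinAt_pi.1 (hy t ht)) i
  -- the clock is the time (component 0): reuse lit-3's socket lemma pattern via the component statements
  have hθ : ∀ t ∈ Icc (0 : ℝ) (15 / 2), HasDerivWithinAt (fun t => y t 0) 1 (Icc (0 : ℝ) (15 / 2)) t := by
    intro t ht; simpa using hcomp t ht 0
  have hclock : ∀ t ∈ Icc (0 : ℝ) (15 / 2), y t 0 = t := by
    have hcont : ContinuousOn (fun t => y t 0 - t) (Icc (0 : ℝ) (15 / 2)) := fun t ht =>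
      ((hθ t ht).continuousWithinAt).sub continuousWithinAt_id
    have hder : ∀ t ∈ Ico (0 : ℝ) (15 / 2), HasDerivWithinAt (fun t => y t 0 - t) 0 (Ici t) t := by
      intro t ht
      have h1 : HasDerivWithinAt (fun t => y t 0) 1 (Ici t) t :=
        (hθ t ⟨ht.1, ht.2.le⟩).mono_of_mem_nhdsWithin (Icc_mem_nhdsGE_of_mem ht)
      have h2 := h1.sub (hasDerivWithinAt_id t (Ici t))
      rwa [sub_self] at h2
    intro t ht
    have := constant_of_has_deriv_right_zero hcont hder t ht
    have h00 : y 0 0 = 0 := by simp [hy0]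
    simp only [h00, sub_zero] at this
    linarith
  have hX : ∀ t ∈ Icc (0 : ℝ) (15 / 2),
      HasDerivWithinAt (fun t => y t 1) ((fun t => y t 2) t / bending 1 (67/100) t) (Icc (0 : ℝ) (15 / 2)) t := by
    intro t ht; have := hcomp t ht 1; simp at this; rwa [hclock t ht] at this
  have hP : ∀ t ∈ Icc (0 : ℝ) (15 / 2),
      HasDerivWithinAt (fun t => y t 2) (-(drive 1 (67/100) t * (fun t => y t 1) t)) (Icc (0 : ℝ) (15 / 2)) t := by
    intro t ht; have := hcomp t ht 2; simp at this; rwa [hclock t ht] at this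
  have hP0 : (fun t => y t 2) 0 = 0 := by simp [hy0]
  obtain ⟨z, hz, ε, hw⟩ := exists_unstableWitnessPW3_of_signChange (s := 1) (α := 67/100) (T' := 15 / 2) (t₁ := 5) (t₂ := 7)
    (δ := 1 / 4) (by norm_num) hX hP hP0 (by norm_num) (by norm_num) (by norm_num) (by norm_num)
    (X_five_pos hy0 hy) (X_seven_neg hy0 hy) (fun t ht => (P_neg hy0 hy ht).ne)
  exact ⟨fun t => y t 1, fun t => y t 2, z, hz, ε, hw⟩

end Summit.Ventures.FusionMHD.Bench.SAlphaU067

end
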